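import Summits.AtomisticToContinuum.HydrodynamicLimit.Theorems.OneFlightGossipEngineAssemblyEntropyProduction
import Summits.AtomisticToContinuum.HydrodynamicLimit.Theorems.JaynesSqueezeHardSphereLDAInversion
import Summits.AtomisticToContinuum.HydrodynamicLimit.Theorems.CollisionIsometryCLTMacroClosureStubLedgerScaling
import Summits.AtomisticToContinuum.HydrodynamicLimit.Theorems.DenseExcursion.Negative.AtTimeZero
import Mathlib.MeasureTheory.SpecificCodomains.WithLp
import HarnessLib

/-!
# Crux `NearConstantShortTimeHL` (stmt-AtomisticToContinuum-12502), line `means-pin-entropy` — statics of the pin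

Support file (`--supports stmt-AtomisticToContinuum-12502`) for the registered stub `stub_meansPin :
GeneralFamilyLDA → GeneralFamilyConcentration → OneMeanLowerBound → NearConstantRelEntropy` (Yau's relative-entropy
bookkeeping at the Euler-matched local Gibbs reference, file `…NearConstantShortTimeHLMeansPin.lean`). This file
collects the STATIC, flow-free ingredients of the pin, for general `(ε, n)` (diameter, particle number):

* the log-profile of the matched local Gibbs law `a = ρ e^{g(ρ)}`:
  `log prof(x, v) = log ρ + g(ρ) − 3/2 log(2πθ) − ‖v − u‖²/(2θ)` (`log_localGibbsProfile_matched`);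
* positivity transfer between partition functions on the SAME hard-sphere domain
  (`canonicalPartition_localGibbs_pos_of_ne_zero`: the crux's law is a probability measure, hence so is the matched
  reference law — no normalisation argument is needed anywhere in the pin);
* `Φ₀ = id` almost surely under Liouville-absolutely-continuous laws (`measure_setOf_flow_zero_mem`);
* uniqueness of limits in probability for vector observables (`eq_of_tendsto_measure_lt_norm`; the real case and
  "equal integrals against continuous test functions ⇒ equal continuous functions" are
  `Theorems.DenseExcursionAtTimeZero.*`) and the identification of two continuous hydrodynamic profile triples
  satisfying the same law of large numbers (`profiles_eq_of_tendsto`): this is how the `t = 0` tie of the crux pins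
  `(ρ^{st}, u₀, θ₀) = (ρ, u, θ)(0)`;
* an exponentially small bound along `n_N → ∞` tends to zero (`tendsto_zero_of_le_exp`);
* the registered sub-goal `activity_inversion_continuous`: `HardSphereLDA.activity_inversion` (PROVED, measurable
  density) upgraded to a CONTINUOUS unit-mass density — the local chemical potential `log + g_σ` is continuous and
  strictly increasing on the band (`HardSphereLDA.eos_calculus`), so its inverse is continuous
  (`HardSphereLDA.exists_extension`).

No definitions. References: H.-T. Yau, Lett. Math. Phys. 22 (1991) §2; H. Spohn, *Large Scale Dynamics of
Interacting Particles* (1991), Part I §2.3.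
-/

noncomputable section

namespace Summit.AtomisticToContinuum.HydrodynamicLimit.Theorems.NearConstantShortTimeHL

open MeasureTheory InformationTheory Set Filter Topology
open scoped ENNReal
open Literature.MathematicalPhysics.KineticTheory Literature.Analysis.FluidPDE Literature.Analysis.FunctionSpaces

/-! ## The log-profile of the matched local Gibbs law -/

/-- **Log-profile of the matched local Gibbs law.** For the activity `a = ρ e^{g(ρ)}` (`ρ, θ > 0`):
`log (localGibbsProfile a u θ (x, v)) = log ρ(x) + g(ρ(x)) − 3/2 log(2π θ(x)) − ‖v − u(x)‖²/(2θ(x))`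
(`dim V3 = 3`). [folklore] -/
theorem log_localGibbsProfile_matched {ρ θ : T3 → ℝ} {u : T3 → V3} (g : ℝ → ℝ) (hρ : ∀ x, 0 < ρ x)
    (hθ : ∀ x, 0 < θ x) (y : T3 × V3) :
    Real.log (localGibbsProfile (fun x => ρ x * Real.exp (g (ρ x))) u θ y) =
      Real.log (ρ y.1) + g (ρ y.1) - 3 / 2 * Real.log (2 * Real.pi * θ y.1) -
        ‖y.2 - u y.1‖ ^ 2 / (2 * θ y.1) := by
  have h2 : 0 < 2 * Real.pi * θ y.1 := mul_pos (mul_pos two_pos Real.pi_pos) (hθ y.1)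
  have hr : 0 < (2 * Real.pi * θ y.1) ^ (-(Module.finrank ℝ V3 : ℝ) / 2) := Real.rpow_pos_of_pos h2 _
  simp only [localGibbsProfile, localMaxwellian, one_mul]
  rw [Real.log_mul (mul_pos (hρ _) (Real.exp_pos _)).ne' (mul_pos hr (Real.exp_pos _)).ne',
    Real.log_mul (hρ _).ne' (Real.exp_pos _).ne', Real.log_exp,
    Real.log_mul hr.ne' (Real.exp_pos _).ne', Real.log_exp, Real.log_rpow h2, finrank_euclideanSpace_fin]
  push_cast
  ring

/-! ## Positivity transfer between partition functions on the same hard-sphere domain -/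

/-- **Positivity transfer between partition functions on the same hard-sphere domain.** If the
canonical partition function of one local Gibbs profile with continuous positive activity and
temperature is nonzero, then that of any other such profile (same diameter, same particle number) is
positive: both are configurational partition functions (`canonicalPartition_eq_posPartition`), whose
position weights compare by the factor `(sup a / inf b)ⁿ`. [folklore] -/
theorem canonicalPartition_localGibbs_pos_of_ne_zero {ε : ℝ} {n : ℕ} {a θ b ϑ : T3 → ℝ} {u w : T3 → V3}
    (ha : Continuous a) (hθ : Continuous θ) (hu : Continuous u) (ha0 : ∀ x, 0 < a x) (hθ0 : ∀ x, 0 < θ x)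
    (hb : Continuous b) (hϑ : Continuous ϑ) (hw : Continuous w) (hb0 : ∀ x, 0 < b x) (hϑ0 : ∀ x, 0 < ϑ x)
    (hZ : canonicalPartition (Torus.geometry (Fin 3)) ε n (localGibbsProfile a u θ) ≠ 0) :
    0 < canonicalPartition (Torus.geometry (Fin 3)) ε n (localGibbsProfile b w ϑ) := by
  rw [canonicalPartition_eq_posPartition ha hθ hu (fun x => (ha0 x).le) hθ0] at hZ
  rw [canonicalPartition_eq_posPartition hb hϑ hw (fun x => (hb0 x).le) hϑ0]
  obtain ⟨A, -, hA⟩ := exists_forall_abs_le_of_continuous ha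
  obtain ⟨x₀, -, hx₀⟩ := isCompact_univ.exists_isMinOn univ_nonempty hb.continuousOn
  set m : ℝ := b x₀ with hm
  have hm0 : 0 < m := hb0 x₀
  have hmb : ∀ x, m ≤ b x := fun x => hx₀ (mem_univ x)
  have hAa : ∀ x, a x ≤ A := fun x => (le_abs_self _).trans (hA x)
  have hA0 : 0 ≤ A := (ha0 0).le.trans (hAa 0)
  -- pointwise comparison of the position weights
  have hle : ∀ x : Fin n → T3, posWeight a ε n x ≤ (A / m) ^ n * posWeight b ε n x := by
    intro x
    unfold posWeight
    by_cases hx : x ∈ posDomain ε n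
    · rw [Set.indicator_of_mem hx, Set.indicator_of_mem hx]
      calc ∏ i, a (x i) ≤ ∏ i, (A / m * b (x i)) :=
            Finset.prod_le_prod (fun i _ => (ha0 _).le) fun i _ => by
              rw [div_mul_eq_mul_div, le_div_iff₀ hm0]
              exact mul_le_mul (hAa _) (hmb _) hm0.le hA0
        _ = (A / m) ^ n * ∏ i, b (x i) := by
            rw [Finset.prod_mul_distrib, Finset.prod_const, Finset.card_univ, Fintype.card_fin]
    · simp [Set.indicator_of_notMem hx]
  have hmono : posPartition a ε n ≤ (A / m) ^ n * posPartition b ε n := by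
    rw [posPartition, posPartition, ← integral_const_mul]
    exact integral_mono_of_nonneg (Eventually.of_forall fun x => posWeight_nonneg (fun y => (ha0 y).le) ε x)
      ((integrable_posWeight hb (fun y => (hb0 y).le) ε n).const_mul _) (Eventually.of_forall hle)
  have hpos : 0 < posPartition a ε n :=
    lt_of_le_of_ne (posPartition_nonneg (fun y => (ha0 y).le) ε n) (Ne.symm hZ)
  have hbn : 0 ≤ posPartition b ε n := posPartition_nonneg (fun y => (hb0 y).le) ε n
  by_contra hcon
  have hb0' : posPartition b ε n = 0 := le_antisymm (not_lt.1 hcon) hbn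
  rw [hb0', mul_zero] at hmono
  exact absurd hmono (not_le.2 hpos)

/-! ## The flow at time zero is the identity almost surely -/

/-- Under a law absolutely continuous with respect to the Liouville measure, the event
`{z | Φ₀ z ∈ A}` has the probability of `A` (`Φ₀ = id` on the conull good set). [folklore] -/
theorem measure_setOf_flow_zero_mem {ε : ℝ} {n : ℕ} (Φ : HardSphereFlow (Torus.geometry (Fin 3)) ε n)
    {μ : Measure (Config n (Fin 3) T3)} (hμ : μ ≪ liouville (Torus.geometry (Fin 3)) n ε)
    (A : Set (Config n (Fin 3) T3)) : μ {z | Φ.flow 0 z ∈ A} = μ A := by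
  refine measure_congr ?_
  filter_upwards [hμ.ae_le Φ.ae_mem_good] with z hz
  simp only [eq_iff_iff]
  show Φ.flow 0 z ∈ A ↔ z ∈ A
  rw [Φ.flow_zero z hz]

/-! ## Uniqueness of limits in probability; identification of continuous profiles -/

/-- Limits in probability are unique (probability laws, observables in a normed group). [folklore] -/
theorem eq_of_tendsto_measure_lt_norm {Ω : ℕ → Type*} [∀ N, MeasurableSpace (Ω N)]
    {E : Type*} [NormedAddCommGroup E] {P : (N : ℕ) → Measure (Ω N)} (hP : ∀ N, IsProbabilityMeasure (P N))
    {F : (N : ℕ) → Ω N → E} {a b : E}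
    (ha : ∀ δ > (0 : ℝ), Tendsto (fun N => P N {z | δ < ‖F N z - a‖}) atTop (𝓝 0))
    (hb : ∀ δ > (0 : ℝ), Tendsto (fun N => P N {z | δ < ‖F N z - b‖}) atTop (𝓝 0)) : a = b := by
  by_contra hab
  have hd : 0 < ‖a - b‖ := norm_pos_iff.2 (sub_ne_zero.2 hab)
  set δ := ‖a - b‖ / 3 with hδ
  have hδ0 : 0 < δ := by positivity
  have hcover : ∀ N, (univ : Set (Ω N)) ⊆ {z | δ < ‖F N z - a‖} ∪ {z | δ < ‖F N z - b‖} := by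
    intro N z _
    by_contra hz
    simp only [Set.mem_union, Set.mem_setOf_eq, not_or, not_lt] at hz
    have : ‖a - b‖ ≤ ‖F N z - a‖ + ‖F N z - b‖ := by
      calc ‖a - b‖ = ‖(F N z - b) - (F N z - a)‖ := by congr 1; abel
        _ ≤ ‖F N z - b‖ + ‖F N z - a‖ := norm_sub_le _ _
        _ = ‖F N z - a‖ + ‖F N z - b‖ := add_comm _ _
    linarith [hz.1, hz.2]
  have hle : ∀ N, (1 : ℝ≥0∞) ≤ P N {z | δ < ‖F N z - a‖} + P N {z | δ < ‖F N z - b‖} := fun N =>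
    calc (1 : ℝ≥0∞) = P N univ := measure_univ.symm
      _ ≤ P N ({z | δ < ‖F N z - a‖} ∪ {z | δ < ‖F N z - b‖}) := measure_mono (hcover N)
      _ ≤ _ := measure_union_le _ _
  have hlim : Tendsto (fun N => P N {z | δ < ‖F N z - a‖} + P N {z | δ < ‖F N z - b‖}) atTop (𝓝 0) := by
    simpa using (ha δ hδ0).add (hb δ hδ0)
  exact absurd (ge_of_tendsto hlim (Eventually.of_forall hle)) (by simp)

/-- **Identification of continuous hydrodynamic profiles by a law of large numbers.** If under the same
probability laws `P_N` the same observables (density / momentum / energy fields tested against every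
continuous `χ`) converge in probability both to `(∫χρ₁, ∫χρ₁u₁, ∫χE(ρ₁,u₁,θ₁))` and to
`(∫χρ₂, ∫χρ₂u₂, ∫χE(ρ₂,u₂,θ₂))`, all profiles continuous and `ρ₁ > 0`, then
`(ρ₁, u₁, θ₁) = (ρ₂, u₂, θ₂)`. [folklore] -/
theorem profiles_eq_of_tendsto {Ω : ℕ → Type*} [∀ N, MeasurableSpace (Ω N)]
    {P : (N : ℕ) → Measure (Ω N)} (hP : ∀ N, IsProbabilityMeasure (P N))
    (D : (N : ℕ) → Ω N → (T3 → ℝ) → ℝ) (Mo : (N : ℕ) → Ω N → (T3 → ℝ) → V3)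
    (En : (N : ℕ) → Ω N → (T3 → ℝ) → ℝ)
    {ρ₁ θ₁ ρ₂ θ₂ : T3 → ℝ} {u₁ u₂ : T3 → V3} (hρ₁ : Continuous ρ₁) (hθ₁ : Continuous θ₁)
    (hu₁ : Continuous u₁) (hρ₂ : Continuous ρ₂) (hθ₂ : Continuous θ₂) (hu₂ : Continuous u₂)
    (hpos : ∀ x, 0 < ρ₁ x)
    (h₁ : ∀ χ : T3 → ℝ, Continuous χ → ∀ δ : ℝ, 0 < δ →
      Tendsto (fun N => P N {z | δ < |D N z χ - ∫ x, χ x * ρ₁ x|}) atTop (𝓝 0) ∧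
      Tendsto (fun N => P N {z | δ < ‖Mo N z χ - ∫ x, (χ x * ρ₁ x) • u₁ x‖}) atTop (𝓝 0) ∧
      Tendsto (fun N => P N {z | δ < |En N z χ - ∫ x, χ x * totalEnergyDensity (ρ₁ x) (u₁ x) (θ₁ x)|})
        atTop (𝓝 0))
    (h₂ : ∀ χ : T3 → ℝ, Continuous χ → ∀ δ : ℝ, 0 < δ →
      Tendsto (fun N => P N {z | δ < |D N z χ - ∫ x, χ x * ρ₂ x|}) atTop (𝓝 0) ∧
      Tendsto (fun N => P N {z | δ < ‖Mo N z χ - ∫ x, (χ x * ρ₂ x) • u₂ x‖}) atTop (𝓝 0) ∧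
      Tendsto (fun N => P N {z | δ < |En N z χ - ∫ x, χ x * totalEnergyDensity (ρ₂ x) (u₂ x) (θ₂ x)|})
        atTop (𝓝 0)) :
    ρ₁ = ρ₂ ∧ u₁ = u₂ ∧ θ₁ = θ₂ := by
  have hPev : ∀ᶠ N in atTop, IsProbabilityMeasure (P N) := Eventually.of_forall hP
  -- density
  have hρ : ρ₁ = ρ₂ := by
    refine DenseExcursionAtTimeZero.eq_of_forall_integral_mul_eq hρ₁ hρ₂ fun χ hχ => ?_
    exact DenseExcursionAtTimeZero.eq_of_tendsto_measure_lt_abs (F := fun N z => D N z χ) hPev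
      (fun δ hδ => (h₁ χ hχ δ hδ).1) (fun δ hδ => (h₂ χ hχ δ hδ).1)
  subst hρ
  -- momentum
  have hmo : ∀ χ : T3 → ℝ, Continuous χ → ∫ x, (χ x * ρ₁ x) • u₁ x = ∫ x, (χ x * ρ₁ x) • u₂ x :=
    fun χ hχ => eq_of_tendsto_measure_lt_norm (F := fun N z => Mo N z χ) hP
      (fun δ hδ => (h₁ χ hχ δ hδ).2.1) (fun δ hδ => (h₂ χ hχ δ hδ).2.1)
  have hu : u₁ = u₂ := by
    have hci : ∀ (w : T3 → V3), Continuous w → ∀ i : Fin 3, Continuous fun x => w x i :=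
      fun w hw i => (EuclideanSpace.proj (𝕜 := ℝ) i).continuous.comp hw
    have hcoord : ∀ i : Fin 3, (fun x => ρ₁ x * u₁ x i) = fun x => ρ₁ x * u₂ x i := by
      intro i
      refine DenseExcursionAtTimeZero.eq_of_forall_integral_mul_eq (hρ₁.mul (hci u₁ hu₁ i)) (hρ₁.mul (hci u₂ hu₂ i))
        fun χ hχ => ?_
      have hint : ∀ (w : T3 → V3), Continuous w → Integrable (fun x => (χ x * ρ₁ x) • w x) volume :=
        fun w hw => integrable_of_continuous_T3 ((hχ.mul hρ₁).smul hw)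
      have h := congrArg (fun v : V3 => v i) (hmo χ hχ)
      simp only at h
      rw [eval_integral_piLp (hint u₁ hu₁).eval_piLp, eval_integral_piLp (hint u₂ hu₂).eval_piLp] at h
      simpa only [PiLp.smul_apply, smul_eq_mul, mul_assoc] using h
    funext x
    refine PiLp.ext fun i => ?_
    exact mul_left_cancel₀ (hpos x).ne' (congrFun (hcoord i) x)
  subst hu
  -- energy
  have hen : (fun x => totalEnergyDensity (ρ₁ x) (u₁ x) (θ₁ x)) = fun x => totalEnergyDensity (ρ₁ x) (u₁ x) (θ₂ x) := by
    refine DenseExcursionAtTimeZero.eq_of_forall_integral_mul_eq ?_ ?_ fun χ hχ => ?_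
    · unfold totalEnergyDensity; fun_prop
    · unfold totalEnergyDensity; fun_prop
    · exact DenseExcursionAtTimeZero.eq_of_tendsto_measure_lt_abs (F := fun N z => En N z χ) hPev
        (fun δ hδ => (h₁ χ hχ δ hδ).2.2) (fun δ hδ => (h₂ χ hχ δ hδ).2.2)
  refine ⟨rfl, rfl, funext fun x => ?_⟩
  have h := congrFun hen x
  simp only [totalEnergyDensity] at h
  have h' := mul_left_cancel₀ (hpos x).ne' h
  linarith

/-! ## Exponentially small bounds along a diverging size -/

/-- An exponentially small bound along a diverging size parameter tends to zero:
`C e^{−m_N/C} → 0` if `m_N → ∞`, hence so does every `[0, ∞]`-valued sequence below it. [folklore] -/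
theorem tendsto_zero_of_le_exp {m : ℕ → ℕ} (hm : Tendsto m atTop atTop) {C : ℝ} (hC : 0 < C)
    {a : ℕ → ℝ≥0∞} (ha : ∀ N, a N ≤ ENNReal.ofReal (C * Real.exp (-(C⁻¹ * (m N : ℝ))))) :
    Tendsto a atTop (𝓝 0) := by
  have hmR : Tendsto (fun N : ℕ => C⁻¹ * (m N : ℝ)) atTop atTop :=
    (tendsto_natCast_atTop_atTop.comp hm).const_mul_atTop (inv_pos.2 hC)
  have h1 : Tendsto (fun N => C * Real.exp (-(C⁻¹ * (m N : ℝ)))) atTop (𝓝 0) := by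
    simpa using (Real.tendsto_exp_neg_atTop_nhds_zero.comp hmR).const_mul C
  have h2 : Tendsto (fun N => ENNReal.ofReal (C * Real.exp (-(C⁻¹ * (m N : ℝ))))) atTop (𝓝 0) := by
    simpa using ENNReal.tendsto_ofReal h1
  exact tendsto_of_tendsto_of_tendsto_of_le_of_le tendsto_const_nhds h2 (fun N => zero_le) ha

/-! ## Activity inversion with a CONTINUOUS density (registered sub-goal) -/

/-- **Activity inversion with a continuous density.** Under the low-density equation of state
(`f_ex = F` on `[0, η₀)`, `F` analytic, `F 0 = 0`) there is `η_A > 0` such that for `σ > 0`, `Λ ≥ 1`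
with `Λ²σ³ ≤ η_A`, every CONTINUOUS activity `Λ⁻¹ ≤ a ≤ Λ` is exactly `a = e^c ρ e^{g_σ(ρ)}` for a
CONTINUOUS unit-mass density `(2Λ²)⁻¹ ≤ ρ ≤ 2Λ²` and a constant `c`
(`HardSphereLDA.activity_inversion`; continuity because the local chemical potential `log + g_σ` is a
continuous strictly increasing function on the band, `HardSphereLDA.eos_calculus`, whose inverse is
continuous, `HardSphereLDA.exists_extension`). [folklore] -/
theorem activity_inversion_continuous :
    ∀ {η₀ : ℝ} {F : ℝ → ℝ}, 0 < η₀ → AnalyticOnNhd ℝ F (Ioo (-η₀) η₀) → EqOn hsExcessFreeEnergy F (Ico 0 η₀) →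
      F 0 = 0 → ∃ ηA : ℝ, 0 < ηA ∧ ∀ σ : ℝ, 0 < σ → ∀ Λ : ℝ, 1 ≤ Λ → Λ ^ 2 * σ ^ 3 ≤ ηA →
      ∀ a : T3 → ℝ, Continuous a → (∀ x, Λ⁻¹ ≤ a x ∧ a x ≤ Λ) →
      ∃ ρa : T3 → ℝ, Continuous ρa ∧ (∀ x, (2 * Λ ^ 2)⁻¹ ≤ ρa x ∧ ρa x ≤ 2 * Λ ^ 2) ∧
        (∫ x, ρa x) = 1 ∧ ∃ c : ℝ, ∀ x, a x = Real.exp c * ρa x *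
          Real.exp (hsExcessFreeEnergy (ρa x * σ ^ 3) + ρa x * σ ^ 3 * deriv hsExcessFreeEnergy (ρa x * σ ^ 3)) := by
  intro η₀ F hη₀ hFa hEq hF0
  obtain ⟨ηA, hηA, hinv⟩ := HardSphereLDA.activity_inversion hη₀ hFa hEq hF0
  obtain ⟨ηc, hηc0, _hηcη₀, C, _hC0, hcalc⟩ := HardSphereLDA.eos_calculus hη₀ hFa hEq
  refine ⟨min ηA (ηc / 2), lt_min hηA (by positivity), fun σ hσ Λ hΛ hpack a ha hab => ?_⟩
  have hσ3 : 0 < σ ^ 3 := pow_pos hσ 3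
  obtain ⟨ρa, hρm, hband, hmass, c, hc⟩ :=
    hinv σ hσ Λ hΛ (hpack.trans (min_le_left _ _)) a ha.measurable hab
  refine ⟨ρa, ?_, hband, hmass, c, hc⟩
  -- the local chemical potential is continuous and strictly increasing on the band
  obtain ⟨k, k₁, hk⟩ := hcalc σ hσ
  set lo : ℝ := (2 * Λ ^ 2)⁻¹ with hlo
  set hi : ℝ := 2 * Λ ^ 2 with hhi
  have hΛ2 : 1 ≤ Λ ^ 2 := one_le_pow₀ hΛ
  have hlo0 : 0 < lo := by rw [hlo]; positivity
  have hlohi : lo ≤ hi := by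
    rw [hlo, hhi]
    exact (inv_le_one_of_one_le₀ (by linarith)).trans (by linarith)
  set G : ℝ → ℝ := fun s => hsExcessFreeEnergy (s * σ ^ 3) + s * σ ^ 3 * deriv hsExcessFreeEnergy (s * σ ^ 3)
    with hG
  set hg : ℝ → ℝ := fun s => Real.log s + G s with hhg
  have hderiv : ∀ s ∈ Icc lo hi, HasDerivAt hg (k s) s ∧ 0 < k s := by
    intro s hs
    have hs0 : 0 < s := hlo0.trans_le hs.1
    have hsc : s * σ ^ 3 ≤ ηc := by
      calc s * σ ^ 3 ≤ hi * σ ^ 3 := mul_le_mul_of_nonneg_right hs.2 hσ3.le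
        _ = 2 * (Λ ^ 2 * σ ^ 3) := by rw [hhi]; ring
        _ ≤ 2 * (ηc / 2) := by gcongr; exact hpack.trans (min_le_right _ _)
        _ = ηc := by ring
    obtain ⟨-, -, hh, hklo, -, -⟩ := hk s hs0 hsc
    exact ⟨hh, lt_of_lt_of_le (by positivity) hklo⟩
  have hgc : ContinuousOn hg (Icc lo hi) := fun s hs => (hderiv s hs).1.continuousAt.continuousWithinAt
  have hgm : StrictMonoOn hg (Icc lo hi) := by
    refine strictMonoOn_of_deriv_pos (convex_Icc lo hi) hgc fun s hs => ?_
    rw [interior_Icc] at hs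
    have hs' : s ∈ Icc lo hi := ⟨hs.1.le, hs.2.le⟩
    rw [(hderiv s hs').1.deriv]
    exact (hderiv s hs').2
  obtain ⟨e, -, hesc, heband⟩ := HardSphereLDA.exists_extension hlohi hgc hgm
  -- `ρa = e⁻¹ ∘ (log a − c)` pointwise, hence continuous
  have hρeq : ∀ x, ρa x = e.symm (Real.log (a x) - c) := by
    intro x
    have hx : ρa x ∈ Icc lo hi := hband x
    have hρ0 : 0 < ρa x := hlo0.trans_le hx.1
    have ha0 : 0 < a x := (inv_pos.2 (one_pos.trans_le hΛ)).trans_le (hab x).1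
    have hval : hg (ρa x) = Real.log (a x) - c := by
      have h1 : Real.log (a x) = c + Real.log (ρa x) + G (ρa x) := by
        rw [hc x, Real.log_mul (mul_pos (Real.exp_pos _) hρ0).ne' (Real.exp_pos _).ne',
          Real.log_mul (Real.exp_pos _).ne' hρ0.ne', Real.log_exp, Real.log_exp]
      rw [hhg]; dsimp only; linarith
    rw [← hval, ← heband _ hx, OrderIso.symm_apply_apply]
  have : ρa = fun x => e.symm (Real.log (a x) - c) := funext hρeq
  rw [this]
  exact hesc.comp ((ha.log fun x => ((inv_pos.2 (one_pos.trans_le hΛ)).trans_le (hab x).1).ne').sub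
    continuous_const)

end Summit.AtomisticToContinuum.HydrodynamicLimit.Theorems.NearConstantShortTimeHL

end
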